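import Summits.ResolutionOfSingularities.ResolutionOfSingularities.Theorems.PurelyInseparableDim4HasseBlowupCommute
import Summits.ResolutionOfSingularities.ResolutionOfSingularities.Theorems.PurelyInseparableDim4ResConeResidualTransform
import Summits.ResolutionOfSingularities.ResolutionOfSingularities.Theorems.PurelyInseparableDim4ResConePowerChain
import Summits.ResolutionOfSingularities.ResolutionOfSingularities.Theorems.PurelyInseparableDim4IsolatedCleaning
import HarnessLib
import HarnessLib.Audit.Tags

/-!
# Purely inseparable four-folds — THE HASSE-CONTACT TRANSPORT LAW OF ONE POINT STEP, ASSEMBLED (slice-B brick K5(b) as ONE theorem):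
# `D_f^{(d−1)}(G′) = (lost units) · chartTransform 1 univ j (shear j b (D_f^{(d−1)} G))` for EVERY translation, cleaning included,
# and its chain edition (cell `res-dim4-pi`, K2(p) lane)

[OURS · counted 0 · cell `res-dim4-pi` · K2(p) lane.  DESIGN = the lane holder res-dim4-p-12 g3's SLICE-B ARCHITECTURE MEMO
(`res-dim4-p-12/SLICE-B-ARCH-g3.md` §1–§2, 2026-08-28, brick K5(b)): «HASSE CONTACT: for f ≠ j FREE (s.r f = 0) and 2 ≤ d ≤ p:
`hasseDeriv (single f (d−1)) (s′.F.divMonomial s′.r) = (∏ …) * chartTransform 1 univ j (shear j b (hasseDeriv (single f (d−1)) G))`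
EXACTLY (the correction dies: C(E_f, d−1) ≡ 0 mod p …; D_f^{(n)} σ* = x_j^n σ* D_f^{(n)} …)».  INGREDIENTS, all in the tree and only
ASSEMBLED here: res-dim4-typ-1 g2's `…HasseBlowupCommute` p677284 (`hasseDeriv_single_shear`, `hasseDeriv_single_chartTransform`,
`hasseDeriv_single_mul_of_free`, `hasseDeriv_single_monomial_eq_zero_of_dvd`) and res-dim4-p-9 g3's `…ResConeResidualTransform` p678057
(`divMonomial_step_F_add_deleted`).  Seat res-dim4-p-11 g6 (whose MAXCONTACT-MEMO §1 rediscovered the law and re-confirmed it numerically,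
`kb/hcontact_check.py` 1150/1150 + 200/200; consumer: the memo's §2 descent and res-dim4-idea-4 g6's «Hasse-contact invariant» text).]
Nothing here proves any TAIL(p, d, 3), K2(7), K2(p), `NoIsolatedTrap p p` or resolution of singularities in dimension ≥ 4 / characteristic
`p` — NOT proved; exact one-step bookkeeping of OUR frame.  AI kernel work, weaker than expert review.

THE LAW.  Point step `s′ = CentreBlowup.step q univ j b s` (`b_j = 0`), `x^r ∣ F`, `ord₀ F = o ≥ q`, residual `G = F / x^r`, shade `d = o − |r|`
with `2 ≤ d ≤ q`, and a letter `f ≠ j` that is FREE at `s` (`r_f = 0`; it may be TRANSLATED, `b_f` arbitrary).  Then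
  **`D_f^{(d−1)} (s′.F / x^{r′}) = (∏_{b_i ≠ 0} (x_i + b_i)^{r_i}) · chartTransform 1 univ j (shear j b (D_f^{(d−1)} G))`**
(`hasseDeriv_divMonomial_step`): apply `D_f^{(d−1)}` to K5(a); the deleted `q`-th-power monomials `x^{E − r′}` have `(E − r′)_f = E_f ≡ 0
(mod q)` (`r′_f = 0`) and die since `1 ≤ d − 1 < q`; the lost-unit product is `x_f`-free (`r_f = 0`); `D_f^{(d−1)}` passes `chartTransform d`
as `chartTransform 1` and commutes with the shear.  Hence the polynomial of maximal contact `h := D_f^{(d−1)} G` transforms as a WEIGHT-ONE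
controlled transform under EVERY step that does not chart `f` — lossy or not, `f` translated or not, cleaning included: `H′ = {h′ = 0}` is the
strict transform of `H = {h = 0}` (times units).  No shade-constancy, power-cone or isolation hypothesis is used; in the T-sector (`ℓ_f ≠ 0`) `h`
has order `1` (`…IsolatedHasseContact`), which is what makes `H` a smooth hypersurface of maximal contact.
* §1 tools: `apply_eq_zero_of_mem_support_prod_lost_units` (the unit product is `x_f`-free when `r_f = 0`), `step_r_apply_eq_zero_of_free`,
  `hasseDeriv_single_sum_deleted_eq_zero`.
* §3 (appended) **`hasseDeriv_single_step_F`** — the F-LEVEL edition for every Hasse order `0 < n < q`: `D_f^{(n)}(s′.F) =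
  chartTransform (q − n) univ j (shear j b (D_f^{(n)} F))` — «the Hasse derivative of the child is the UNCLEANED child, with exponent `q − n`, of the
  Hasse derivative» (cleaning inert below order `q`, `IsolatedBand.hasseDeriv_deletePthPowers`; then p677284); no boundary / shade hypothesis at
  all.  With res-dim4-p-1 g7's slice law `…HeavyLetterSlices` this transports the higher coefficient pairs `(D_f^{(i)}F_e, q − e − i)` of
  MAXCONTACT §2.
* §2 **`hasseDeriv_divMonomial_step`** (the law) and **`chain_hasseDeriv_divMonomial_step`**: along a witnessed isolated above-floor `Step0 p`
  chain with `x^{r₀} ∣ F₀` and constant shade `2 ≤ d ≤ p` from `k₀`, for a letter `f` with `j k ≠ f` and `r_k f = 0` at every `k ≥ k₀`, the law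
  holds at every `k ≥ k₀` (`chain_shade_nat`, `isolated_chain_forall_le`).  In T-normal form the carrier is never charted (res-dim4-p-1 g6), so
  this is the WHOLE tail: the architecture's K6 «letter switch» never occurs.
[cite: EGAIV4, Thm. 16.11.2 (Hasse–Schmidt operators)] [cite: Hauser2010, §§F–G, §I] [cite: CossartJannsenSaito2020, Lemma 13.2, Thm. 13.7]
bears_on: LADDER-RESOLUTION:D157-DOOR2 (res-dim4-pi · K2(p) slice B · K5(b) assembled · B-LOSSY maximal contact).  Supports
stmt-ResolutionOfSingularities-16155 (helper).
-/

set_option linter.dupNamespace false -- mandated namespace of this single-conjunct summit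

noncomputable section

namespace Summit.ResolutionOfSingularities.ResolutionOfSingularities.Theorems.PIDim4

namespace ResCone

open MvPolynomial Finset
open Literature.AlgebraicGeometry.Resolution
open Literature.AlgebraicGeometry.Resolution.CentreBlowup
open Literature.AlgebraicGeometry.Resolution.Hauser2010
open Literature.AlgebraicGeometry.Resolution.HauserPerlega2019

variable {K : Type} [Field K]

/-! ## 1. Tools -/

section Tools

variable [DecidableEq K]

omit [DecidableEq K] in
/-- `degreeOf f (x_i + c) ≤ [i = f]`. [folklore] -/
theorem degreeOf_X_add_C_le (f i : Fin 4) (c : K) :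
    degreeOf f (X i + C c : MvPolynomial (Fin 4) K) ≤ if i = f then 1 else 0 := by
  refine (degreeOf_add_le _ _ _).trans (max_le ?_ ?_)
  · rw [degreeOf_X]
    by_cases h : i = f
    · subst h; simp
    · rw [if_neg (Ne.symm h), if_neg h]
  · rw [degreeOf_C]; exact Nat.zero_le _

/-- **The lost-unit product `∏_{b_i ≠ 0} (x_i + b_i)^{r_i}` is `x_f`-free when `r_f = 0`.** [folklore] -/
theorem apply_eq_zero_of_mem_support_prod_lost_units (b : Fin 4 → K) (r : Fin 4 →₀ ℕ) {f : Fin 4} (hrf : r f = 0)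
    {e : Fin 4 →₀ ℕ} (he : e ∈ (∏ i ∈ Finset.univ.filter (fun i => b i ≠ 0), (X i + C (b i)) ^ (r i) :
      MvPolynomial (Fin 4) K).support) : e f = 0 := by
  have hdeg : degreeOf f (∏ i ∈ Finset.univ.filter (fun i => b i ≠ 0), (X i + C (b i)) ^ (r i) : MvPolynomial (Fin 4) K) = 0 := by
    refine Nat.eq_zero_of_le_zero ((degreeOf_prod_le _ _ _).trans ?_)
    refine (Finset.sum_le_sum fun i _ => (degreeOf_pow_le _ _ _).trans
      (Nat.mul_le_mul_left _ (degreeOf_X_add_C_le f i (b i)))).trans ?_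
    rw [Finset.sum_eq_zero]
    intro i _
    by_cases h : i = f
    · subst h; rw [hrf, zero_mul]
    · rw [if_neg h, mul_zero]
  have h := monomial_le_degreeOf f he
  rw [hdeg] at h
  exact Nat.eq_zero_of_le_zero h

/-- The new boundary vanishes at a letter `f ≠ j` that was free: `r′_f = 0`. [folklore] [cite: HauserPerlega2019PRIMS, §2 (transform D′ of D)] -/
theorem step_r_apply_eq_zero_of_free (q : ℕ) {f j : Fin 4} (hfj : f ≠ j) (b : Fin 4 → K) (s : State K) (hrf : s.r f = 0) :
    (CentreBlowup.step q Finset.univ j b s).r f = 0 := by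
  show CentreBlowup.newMult q Finset.univ j b s f = 0
  unfold CentreBlowup.newMult
  rw [Finsupp.coe_update, Function.update_of_ne hfj, Finsupp.filter_apply]
  split_ifs
  · exact hrf
  · rfl

omit [DecidableEq K] in
/-- **`D_f^{(n)}` KILLS THE CLEANING CORRECTION** (`0 < n < q`): the deleted `q`-th-power monomials `x^{E − r′}` of K5(a) all have
`(E − r′)_f = E_f ≡ 0 (mod q)` when `r′_f = 0`. [OURS · bookkeeping] [cite: Hauser2010, §I ("p-th power monomials")] -/
theorem hasseDeriv_single_sum_deleted_eq_zero (q : ℕ) [Fact q.Prime] [CharP K q] {f : Fin 4} {n : ℕ} (hn0 : 0 < n) (hnq : n < q)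
    (T : MvPolynomial (Fin 4) K) {r' : Fin 4 →₀ ℕ} (hr' : r' f = 0) :
    hasseDeriv (Finsupp.single f n)
      (∑ E ∈ T.support with IsPthPowerExponent q E, monomial (E - r') (coeff E T)) = 0 := by
  rw [Equimultiple.hasseDeriv_eq, map_sum, Finset.sum_eq_zero]
  intro E hE
  have hP : IsPthPowerExponent q E := (Finset.mem_filter.mp hE).2
  have hdvd : q ∣ (E - r') f := by
    rw [Finsupp.tsub_apply, hr', Nat.sub_zero]
    exact (isPthPowerExponent_iff q E).mp hP f
  rw [← Equimultiple.hasseDeriv_eq]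
  exact hasseDeriv_single_monomial_eq_zero_of_dvd q hn0 hnq hdvd _

end Tools

/-! ## 2. The law, and its chain edition -/

section Law

variable [DecidableEq K]

/-- **THE HASSE-CONTACT TRANSPORT LAW OF ONE POINT STEP** (slice-B K5(b), assembled): for `s′ = step q univ j b s` (`b_j = 0`), `x^r ∣ F`,
`ord₀ F = o ≥ q`, `d = o − |r|` with `2 ≤ d ≤ q`, and a letter `f ≠ j` free at `s` (`r_f = 0`, translation `b_f` arbitrary):
`D_f^{(d−1)} (s′.F / x^{r′}) = (∏_{b_i ≠ 0} (x_i + b_i)^{r_i}) · chartTransform 1 univ j (shear j b (D_f^{(d−1)} (F / x^r)))`.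
[OURS · design res-dim4-p-12 g3 SLICE-B-ARCH K5(b); ingredients p677284 / p678057] [cite: EGAIV4, Thm. 16.11.2]
[cite: Hauser2010, §§F–G, §I] -/
theorem hasseDeriv_divMonomial_step (q : ℕ) [Fact q.Prime] [CharP K q] {f j : Fin 4} (hfj : f ≠ j) {b : Fin 4 → K}
    (hbj : b j = 0) (s : State K) {o d : ℕ} (ho : ordZero s.F = o) (hr : ∀ e ∈ s.F.support, s.r ≤ e) (hqo : q ≤ o)
    (hd : o - s.r.degree = d) (hd2 : 2 ≤ d) (hdq : d ≤ q) (hrf : s.r f = 0) :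
    hasseDeriv (Finsupp.single f (d - 1))
        ((CentreBlowup.step q Finset.univ j b s).F.divMonomial (CentreBlowup.step q Finset.univ j b s).r) =
      (∏ i ∈ Finset.univ.filter (fun i => b i ≠ 0), (X i + C (b i)) ^ (s.r i)) *
        chartTransform 1 Finset.univ j (shear j b (hasseDeriv (Finsupp.single f (d - 1)) (s.F.divMonomial s.r))) := by
  have hmain := divMonomial_step_F_add_deleted (q := q) j hbj ho hr hqo
  rw [hd] at hmain
  have hD := congrArg (hasseDeriv (K := K) (Finsupp.single f (d - 1))) hmain
  have hadd : ∀ P Q : MvPolynomial (Fin 4) K, hasseDeriv (Finsupp.single f (d - 1)) (P + Q) =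
      hasseDeriv (Finsupp.single f (d - 1)) P + hasseDeriv (Finsupp.single f (d - 1)) Q := fun P Q => by
    rw [Equimultiple.hasseDeriv_eq, Equimultiple.hasseDeriv_eq, Equimultiple.hasseDeriv_eq, map_add]
  rw [hadd, hasseDeriv_single_sum_deleted_eq_zero q (by omega) (by omega) _
      (step_r_apply_eq_zero_of_free q hfj b s hrf), add_zero,
    hasseDeriv_single_mul_of_free (fun e he => apply_eq_zero_of_mem_support_prod_lost_units b s.r hrf he),
    hasseDeriv_single_chartTransform hfj (show d - 1 ≤ d by omega), show d - (d - 1) = 1 by omega,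
    hasseDeriv_single_shear hfj] at hD
  exact hD

/-- **CHAIN EDITION**: along a witnessed isolated above-floor `Step0 p` chain with `x^{r₀} ∣ F₀` and constant shade `d` (`2 ≤ d ≤ p`) from
`k₀`, for a letter `f` that is never the chart letter and carries no boundary weight from `k₀` on (`j k ≠ f`, `r_k f = 0`; `f` MAY be
translated), the Hasse-contact transport law holds at EVERY step `k ≥ k₀`:
`D_f^{(d−1)} (F_{k+1} / x^{r_{k+1}}) = (∏_{b_k i ≠ 0} (x_i + b_k i)^{r_k i}) · chartTransform 1 univ (j k) (shear (j k) (b k) (D_f^{(d−1)} (F_k / x^{r_k})))`.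
In T-normal form (`f` = the form-carrying free letter, never charted) this is the whole tail. [OURS] [cite: EGAIV4, Thm. 16.11.2]
[cite: CossartJannsenSaito2020, Lemma 13.2, Thm. 13.7] -/
theorem chain_hasseDeriv_divMonomial_step (p : ℕ) [Fact p.Prime] [CharP K p] {c : ℕ → State K} {j : ℕ → Fin 4}
    {b : ℕ → Fin 4 → K} (hc : ∀ k, IsIsolated p (c k).F ∧ Step0 p (c k) (c (k + 1))) (hw : FreeTail.IsWitnessedChain p c j b)
    (hr0 : ∀ e ∈ (c 0).F.support, (c 0).r ≤ e) (hfloor : ∀ k, ordZero (c k).F ≠ p) {k₀ d : ℕ}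
    (hshade : ∀ k, k₀ ≤ k → (c k).shade = (d : ℕ∞)) (hd2 : 2 ≤ d) (hdp : d ≤ p) {f : Fin 4}
    (hjf : ∀ k, k₀ ≤ k → j k ≠ f) (hrf : ∀ k, k₀ ≤ k → (c k).r f = 0) {k : ℕ} (hk : k₀ ≤ k) :
    hasseDeriv (Finsupp.single f (d - 1)) ((c (k + 1)).F.divMonomial (c (k + 1)).r) =
      (∏ i ∈ Finset.univ.filter (fun i => b k i ≠ 0), (X i + C (b k i)) ^ ((c k).r i)) *
        chartTransform 1 Finset.univ (j k) (shear (j k) (b k)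
          (hasseDeriv (Finsupp.single f (d - 1)) ((c k).F.divMonomial (c k).r))) := by
  obtain ⟨o, ho, hpo, -, hod⟩ := chain_shade_nat p hc hfloor hshade hk
  obtain ⟨-, hbj, -, -, hstep⟩ := hw k
  rw [hstep]
  exact hasseDeriv_divMonomial_step p (hjf k hk).symm hbj (c k) ho (IsolatedBand.isolated_chain_forall_le hc hr0 k) hpo.le hod
    hd2 hdp (hrf k hk)

end Law

/-! ## 3. The F-level edition (appended): Hasse derivatives of the child, every order `0 < n < q` -/

section FLevel

variable [DecidableEq K]

/-- **THE HASSE DERIVATIVE OF THE CHILD IS THE UNCLEANED CHILD OF THE HASSE DERIVATIVE** (point step, chart `x_j`, chart point `b`, `b_j = 0`,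
`q ≤ ord F`; letter `f ≠ j`, Hasse order `0 < n < q`; ANY translation, `b_f` arbitrary):
`D_f^{(n)} ((step q univ j b s).F) = chartTransform (q − n) univ j (shear j b (D_f^{(n)} F))`.  Cleaning is inert for Hasse derivatives of order
`< q` (Lucas), `D_f^{(n)}` turns the chart exponent `q` into `q − n` and commutes with the shear. [OURS · assembly of p677284 +
`IsolatedBand.hasseDeriv_deletePthPowers`] [cite: EGAIV4, Thm. 16.11.2] [cite: Hauser2010, §§F–G, §I] -/
theorem hasseDeriv_single_step_F (q : ℕ) [Fact q.Prime] [CharP K q] {f j : Fin 4} (hfj : f ≠ j) {b : Fin 4 → K} (hbj : b j = 0)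
    (s : State K) (hq : (q : ℕ∞) ≤ ordAlong Finset.univ s.F) {n : ℕ} (hn0 : 0 < n) (hnq : n < q) :
    hasseDeriv (Finsupp.single f n) (CentreBlowup.step q Finset.univ j b s).F =
      chartTransform (q - n) Finset.univ j (shear j b (hasseDeriv (Finsupp.single f n) s.F)) := by
  have hdeg : (Finsupp.single f n).degree = n := Finsupp.degree_single f n
  rw [step_F_eq_deletePthPowers_chartTransform_shear q j hbj s hq,
    IsolatedBand.hasseDeriv_deletePthPowers q _ (by rw [hdeg]; exact hn0) (by rw [hdeg]; exact hnq),
    hasseDeriv_single_chartTransform hfj hnq.le, hasseDeriv_single_shear hfj]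

/-- **Chain edition of the F-level law**: along a witnessed chain, at every step `k` whose chart letter is not `f`, for every `0 < n < p`:
`D_f^{(n)} F_{k+1} = chartTransform (p − n) univ (j k) (shear (j k) (b k) (D_f^{(n)} F_k))`. [OURS] [cite: EGAIV4, Thm. 16.11.2] -/
theorem chain_hasseDeriv_single_step_F (p : ℕ) [Fact p.Prime] [CharP K p] {c : ℕ → State K} {j : ℕ → Fin 4} {b : ℕ → Fin 4 → K}
    (hw : FreeTail.IsWitnessedChain p c j b) {f : Fin 4} {k : ℕ} (hjf : j k ≠ f) {n : ℕ} (hn0 : 0 < n) (hnp : n < p) :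
    hasseDeriv (Finsupp.single f n) (c (k + 1)).F =
      chartTransform (p - n) Finset.univ (j k) (shear (j k) (b k) (hasseDeriv (Finsupp.single f n) (c k).F)) := by
  obtain ⟨hq, hbj, -, -, hstep⟩ := hw k
  rw [hstep]
  exact hasseDeriv_single_step_F p hjf.symm hbj (c k) hq hn0 hnp

end FLevel

end ResCone

end Summit.ResolutionOfSingularities.ResolutionOfSingularities.Theorems.PIDim4

end
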